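import Summits.HubbardSuperconductivity.HubbardSuperconductivity.Theorems.AnisotropyChordKnnInterval16
import Summits.HubbardSuperconductivity.HubbardSuperconductivity.Theorems.AnisotropyChordKnnInterval18
import Summits.HubbardSuperconductivity.HubbardSuperconductivity.Theorems.AnisotropyChordKnnInterval20
import Summits.HubbardSuperconductivity.HubbardSuperconductivity.Theorems.AnisotropyChordKnnInterval23
import Summits.HubbardSuperconductivity.HubbardSuperconductivity.Theorems.AnisotropyChordKnnInterval26
import Summits.HubbardSuperconductivity.HubbardSuperconductivity.Theorems.AnisotropyChordKnnInterval28
import Summits.HubbardSuperconductivity.HubbardSuperconductivity.Theorems.AnisotropyChordKnnInterval30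
import Summits.HubbardSuperconductivity.HubbardSuperconductivity.Theorems.AnisotropyChordKnnInterval32Data

/-!
# Route `AnisotropyChord` / H0 rotor rung, K_{n,n} sibling of XY-LM₀: **`XYLiebMattisKnn n Δ` for every `n ≤ 32` and every
# `Δ ∈ [0, 63/64]`** — the booked family «K_{n,n}, s ≤ 16» on the whole easy-plane ferromagnetic side up to the perturbative
# corner, KERNEL-CHECKED (prover seat `hubbard-h0-rotor-p1` g13; theory seat THEOREMS M12–M20, director ruling CYCLE 12 (B))

Chain, all in Lean: M12 (definitional) + THEOREM Q (`…KnnTwoLevel`, all `n`, all `η > 0`) + LEMMA R (`…KnnMLR`) + the budget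
conditions (S_M) for every REAL `η = 1 − Δ ∈ [1/64, 1]` from the interval tables `xyICerts10 … xyICerts32` (about 830 records;
`…KnnInterval`: the block is affine in `η`, two endpoint certificates with a shared test vector per interval).  For `n ≤ 20` the
tables reach `η = 9/5` (`Δ ≥ −4/5`): `xyLiebMattisKnn_interval_of_le_20`.  Not covered: the corner `Δ ∈ (63/64, 1)` (perturbative
regime, both sides of (S_M) vanish ∝ η) — and nothing here is a statement about tori or about the Hubbard model.
-/

set_option linter.dupNamespace false
set_option autoImplicit false

namespace Summit.HubbardSuperconductivity.HubbardSuperconductivity.Theorems.AnisotropyChord.Knn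

/-- (S_M) for all `4 ≤ n ≤ 32`, `M + 4 ≤ n`, every real `η ∈ [1/64, 1]`, from the eight interval tables. [folklore] -/
theorem budgetCondition_interval_of_le_32 {n M : ℕ} (hn : n ≤ 32) (hM : M + 4 ≤ n) {η : ℝ}
    (h1 : ((1 / 64 : ℚ) : ℝ) ≤ η) (h2 : η ≤ ((1 : ℚ) : ℝ)) : BudgetCondition n M η := by
  have h2' : η ≤ ((9 / 5 : ℚ) : ℝ) := h2.trans (by norm_num)
  by_cases h16 : n ≤ 16
  · exact budgetCondition_interval_of_le_16 h16 hM h1 h2'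
  by_cases h18 : n ≤ 18
  · exact budgetCondition_of_icertsOK xyICerts18_ok (by omega) h18 hM h1 h2'
  by_cases h20 : n ≤ 20
  · exact budgetCondition_of_icertsOK xyICerts20_ok (by omega) h20 hM h1 h2'
  by_cases h23 : n ≤ 23
  · exact budgetCondition_of_icertsOK xyICerts23_ok (by omega) h23 hM h1 h2
  by_cases h26 : n ≤ 26
  · exact budgetCondition_of_icertsOK xyICerts26_ok (by omega) h26 hM h1 h2
  by_cases h28 : n ≤ 28
  · exact budgetCondition_of_icertsOK xyICerts28_ok (by omega) h28 hM h1 h2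
  by_cases h30 : n ≤ 30
  · exact budgetCondition_of_icertsOK xyICerts30_ok (by omega) h30 hM h1 h2
  · exact budgetCondition_of_icertsOK xyICerts32_ok (by omega) hn hM h1 h2

/-- **`XYLiebMattisKnn n Δ` for `n ≤ 20` on `Δ ∈ [−4/5, 63/64]`** (tables reaching `η = 9/5`). [conjecture: theory seat
hubbard-h0-rotor-theory-1, cycle 12 — decided instance family (M17/M20); Lean proof here] -/
theorem xyLiebMattisKnn_interval_of_le_20 {n : ℕ} (hn : n ≤ 20) {Δ : ℝ} (h1 : -(4 / 5 : ℝ) ≤ Δ) (h2 : Δ ≤ 63 / 64) :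
    XYLiebMattisKnn n Δ := by
  apply xyLiebMattisKnn_of_budgets (by linarith)
  intro M hM
  have e1 : ((1 / 64 : ℚ) : ℝ) ≤ 1 - Δ := by push_cast; linarith
  have e2 : 1 - Δ ≤ ((9 / 5 : ℚ) : ℝ) := by push_cast; linarith
  by_cases h16 : n ≤ 16
  · exact budgetCondition_interval_of_le_16 h16 hM e1 e2
  by_cases h18 : n ≤ 18
  · exact budgetCondition_of_icertsOK xyICerts18_ok (by omega) h18 hM e1 e2
  · exact budgetCondition_of_icertsOK xyICerts20_ok (by omega) hn hM e1 e2

/-- **THEOREM OF RECORD, CONTINUUM FORM (XY-Lieb–Mattis ordering on `K_{n,n}`, all `n ≤ 32`, all `Δ ∈ [0, 63/64]`,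
kernel-checked):** for every `n ≤ 32` and every real `Δ` with `0 ≤ Δ ≤ 63/64`, `XYLiebMattisKnn n Δ` — in the two-big-spin Jacobi
reduction `P_M(1 − Δ)` of the spin-½ XXZ model on `K_{n,n}` (THEOREMS M12, definitional as typed by the theory seat) the sector
ground states' `⟨S⃗²⟩` is non-decreasing in `|Sᶻ_tot|`.  This is the theory seat's THEOREM Q⁺ / «decided instance family
s ≤ 16» on the easy-plane ferromagnetic side, minus the perturbative corner `Δ ∈ (63/64, 1)`, as a Lean theorem (THEOREM Q +
LEMMA R + interval certificates; no `native_decide`, standard axioms).  Not a statement about tori (XY-LM₀ stays OPEN) or Hubbard.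
[conjecture: theory seat hubbard-h0-rotor-theory-1, cycle 12 — THEOREM Q⁺ (M20) decided family; Lean proof here] -/
theorem xyLiebMattisKnn_interval_of_le_32 {n : ℕ} (hn : n ≤ 32) {Δ : ℝ} (h1 : (0 : ℝ) ≤ Δ) (h2 : Δ ≤ 63 / 64) :
    XYLiebMattisKnn n Δ := by
  apply xyLiebMattisKnn_of_budgets (by linarith)
  intro M hM
  exact budgetCondition_interval_of_le_32 hn hM (by push_cast; linarith) (by push_cast; linarith)

end Summit.HubbardSuperconductivity.HubbardSuperconductivity.Theorems.AnisotropyChord.Knn
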